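import Literature.IUT.HodgeArakelov.RealifiedPrimeStripSplitMuLift
import Literature.IUT.HodgeArakelov.KummerPrimeStripsNonVacuity
import Mathlib.NumberTheory.Padics.PadicIntegers
import Mathlib.Logic.Function.Basic

/-!
# [IUTchII] Def 4.9 (viii): an explicit `F^{⊩▶×μ}`-prime-strip (strip-level NON-VACUITY of the print-level groupoid)
# and the CONNECTED COMPONENT of a model, on which the kit rule holds and `F^{⊩▶×μ} ↦ F^{⊢×μ}` is full

Companion file (abc-iut cell, layer L6; abc-iut-w5-d087, from the RQ7 audit of abc-iut-w4-d028's
`RealifiedPrimeStripSplitMuLift` p415182 over abc-iut-L6-t2's `RealifiedPrimeStripSplitCategories`; nothing landed is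
re-typed). S. Mochizuki, *Inter-universal Teichmüller theory II*, kurims Dec-2020 manuscript, Def 4.9 (ii) p. 155
(«`O^{▶×μ}(‡A) := O^▶(‡A) × O^{×μ}(‡A)` for the direct product monoid»), (vii)–(viii) p. 158 («a collection of data
that is isomorphic to `‡F_v`»; «the generators of the monoids `O^▶(−)` [each of which is abstractly isomorphic to `ℕ`]
of the data at `v ∈ V^bad` … together with the `{∗ρ_w}` determine … the pilot object … of negative arithmetic degree»),
Cor 4.10 (iv) p. 160 («coincides with the full poly-isomorphism»); *III*, kurims May-2020 manuscript, Thm 2.2 (i) p. 65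
(«the second arrows in each line are surjections»). [claim: Mochizuki2012, status: disputed] — nothing here asserts a
disputed claim or takes a side on [IUTchIII] Cor 3.12.

Context. abc-iut-w4-d014's `RealifiedPrimeStripSplitKitRuleWitness` (p416106, finding F-d014-RPS-1) shows that the
∀-form kit rule `∀ S, Nonempty (S ≅ M)` over the whole record type `FVdashSplitTriMuPrimeStrip P G X` is
UNSATISFIABLE (so the `_of_model` forms of p415182 hold vacuously) and records the repair «build strip frames on the
full subgroupoid `{S | Nonempty (S ≅ M)}`». This file supplies (a) an ABSOLUTE inhabitant of the record type (until now
only the LOCAL data were witnessed, `nonempty_nonarchTriMuDatum`) and (b) that full subgroupoid with the statements a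
strip frame consumes, plus (c) the `O^▷`-level twin of F-d014-RPS-1.

* §1 `FVdashSplitTriMuPrimeStrip.Witness.*` — for every prime `p` and every `l`, an EXPLICIT `F^{⊩▶×μ}`-prime-strip over
  ONE bad place: local monoid `O^▷ = ℤ_[p] ∖ {0}` (trivial Galois action, the tautological Kummer structures of
  `KummerPrimeStripsNonVacuity`, splitting `p^ℕ`), valuation `ρ = ord_p` descended to `O^▶ = O^▷/O^×`, generator `p`
  with `ρ(p) = 1 > 0`, global realified Frobenioid `(ℝ, =, deg = id)` with one local component, pilot object `−1`
  (`= −ρ(generator)`): `Witness.nonempty`; hence [IUTchIII] Thm 2.2 (i) `mapAut_toTimesMu_surjective` (p415182) is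
  certified NON-VACUOUS (`Witness.mapAut_toTimesMu_surjective_strip`).
* §2 `FVdashTriMuPrimeStripF.not_forall_nonempty_iso` — the `O^▷`-LEVEL twin of F-d014-RPS-1 for abc-iut-L6-t2's
  `RealifiedPrimeStripCategories` groupoid (morphisms carry a bijection of OBJECTS of `∗C^⊩`): duplicating every object
  `Set Obj`-many times gives a strip `dup M` with no `dup M ≅ M` (Cantor), so `FVdashTriMuPrimeStripF.iso_nonempty_of_model`'s
  hypothesis is never instantiable either.
* §3 the CONNECTED COMPONENT `KitComponent M := {S | Nonempty (S ≅ M)}` as Mathlib's `ObjectProperty.FullSubcategory`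
  (print's «collection of data … isomorphic to `‡F`» as a TYPE): `KitComponent.iso_nonempty` (the kit rule HOLDS there,
  by definition), `KitComponent.mapIso_toTimesMu_surjective` (passing to `F^{⊢×μ}` along the inclusion is surjective on
  EVERY `Isom(A, B)`), `KitComponent.map_full_toTimesMu` (Cor 4.10 (iv): the full poly-isomorphism maps ONTO the full
  poly-isomorphism for all `A B`), and the pairwise form `map_full_toTimesMu_of_iso (e : S ≅ T)` over the record type —
  the frame-level residual `R` of `LogThetaLattice/UnitMuCoricFrame` in a currency a `StripFrame`/`TimesMuSide` with
  `Fglxm := KitComponent M` can actually consume (owner of that assembly: abc-iut-L6-t3, `StripFrame.ofKits`).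

Deliberately NOT here: any change to the landed records/groupoids (owner abc-iut-L6-t2), the components for
`F^{⊢▶×μ}`/`F^{⊢×μ}` and the restricted functors between the three components (the `TimesMuSide` assembly, L6-t3),
judgement.
-/
noncomputable section

namespace Literature.IUT.HodgeArakelov

open CategoryTheory
open Literature.IUT.HodgeTheaters (PolyIso)
open scoped nonZeroDivisors NNReal

universe u v w

/-! ### §1 An explicit `F^{⊩▶×μ}`-prime-strip over one bad place -/

namespace FVdashSplitTriMuPrimeStrip

namespace Witness

/-- `ℕ ↪ (ℝ_{≥0}, +)` on `Multiplicative` tags (bookkeeping for `ρ`). [folklore] -/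
def castHom : Multiplicative ℕ →* Multiplicative ℝ≥0 :=
  AddMonoidHom.toMultiplicative (Nat.castAddMonoidHom ℝ≥0)

/-- Value of `castHom` (private plumbing). [folklore] -/
private theorem castHom_apply (n : Multiplicative ℕ) :
    castHom n = Multiplicative.ofAdd ((Multiplicative.toAdd n : ℕ) : ℝ≥0) := rfl

section Padic

variable (p : ℕ) [Fact p.Prime]

/-- `ord_p` on the non-zero-divisors `ℤ_[p] ∖ {0}`, as a monoid homomorphism into `Multiplicative ℕ`
(classical: `ord_p(xy) = ord_p(x) + ord_p(y)`). [folklore] -/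
def val0 : (ℤ_[p])⁰ →* Multiplicative ℕ where
  toFun x := Multiplicative.ofAdd (PadicInt.valuation (x : ℤ_[p]))
  map_one' := by simp
  map_mul' x y := by
    have hx : ((x : (ℤ_[p])⁰) : ℤ_[p]) ≠ 0 := nonZeroDivisors.coe_ne_zero x
    have hy : ((y : (ℤ_[p])⁰) : ℤ_[p]) ≠ 0 := nonZeroDivisors.coe_ne_zero y
    rw [Submonoid.coe_mul, PadicInt.valuation_mul hx hy, ofAdd_add]

/-- Value of `val0` (private plumbing). [folklore] -/
private theorem val0_apply (x : (ℤ_[p])⁰) : val0 p x = Multiplicative.ofAdd (PadicInt.valuation (x : ℤ_[p])) := rfl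

/-- Units of the monoid `ℤ_[p] ∖ {0}` have `ord_p = 0` (private plumbing). [folklore] -/
private theorem val0_unit (u : ((ℤ_[p])⁰)ˣ) : val0 p (u : (ℤ_[p])⁰) = 1 := by
  have h : val0 p (u : (ℤ_[p])⁰) * val0 p (↑u⁻¹ : (ℤ_[p])⁰) = 1 := by
    rw [← map_mul, Units.mul_inv, map_one]
  have h' : Multiplicative.toAdd (val0 p (u : (ℤ_[p])⁰)) +
      Multiplicative.toAdd (val0 p (↑u⁻¹ : (ℤ_[p])⁰)) = 0 := by
    rw [← toAdd_mul, h, toAdd_one]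
  apply Multiplicative.toAdd.injective
  rw [toAdd_one]
  omega

/-- `ord_p` descended to `O^▶ = O^▷/O^×` (`OTri = Associates`) of the monoid `ℤ_[p] ∖ {0}` — the valuation
`ρ_v : O^▶ → ℝ_{≥0}` of [IUTchII] Def 4.9 (viii) before realification. [folklore] -/
def trival : OTri (CommMonCat.of (ℤ_[p])⁰) →* Multiplicative ℕ where
  toFun a := Quotient.liftOn a (fun x => val0 p x) (fun x y (h : Associated x y) => by
    obtain ⟨u, rfl⟩ := h
    show val0 p x = val0 p (x * u)
    rw [map_mul, val0_unit, mul_one])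
  map_one' := by
    show val0 p 1 = 1
    exact map_one _
  map_mul' a b := Quotient.inductionOn₂ a b fun x y => by
    show val0 p (x * y) = val0 p x * val0 p y
    exact map_mul _ _ _

/-- `trival` on a class (private plumbing). [folklore] -/
private theorem trival_mk (x : (ℤ_[p])⁰) : trival p (Associates.mk x) = val0 p x := rfl

/-- The valuation `ρ : O^▶ → (ℝ_{≥0}, +)` of the witness strip at its one (bad) place: `ord_p`, realified.
[cite: Mochizuki2012, Def 4.9 (viii) p.158] -/
def rho : OTri (CommMonCat.of (ℤ_[p])⁰) →* Multiplicative ℝ≥0 := castHom.comp (trival p)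

/-- The uniformizer `p` of `ℤ_[p]` as a non-zero-divisor (the generator of `O^▶ ≅ ℕ` at the bad place,
Def 4.9 (viii) «each of which is abstractly isomorphic to `ℕ`»). [folklore] -/
def varpi : (ℤ_[p])⁰ :=
  ⟨(p : ℤ_[p]), mem_nonZeroDivisors_of_ne_zero (PadicInt.irreducible_p (p := p)).ne_zero⟩

/-- `ρ(p) = 1`: the valuation of the generator of `O^▶` at the bad place ([IUTchII] Def 4.9 (viii) «the
generators of the monoids `O^▶(−)` … together with the `{∗ρ_w}` determine … the pilot object»).
[cite: Mochizuki2012, Def 4.9 (viii) p.158] -/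
theorem rho_varpi : rho p (toOTri _ (varpi p)) = Multiplicative.ofAdd (1 : ℝ≥0) := by
  show castHom (trival p (Associates.mk (varpi p))) = _
  rw [trival_mk, castHom_apply, val0_apply]
  simp [varpi]

end Padic

/-- Place data: ONE place, which is bad, and the prime `l`. [cite: Mochizuki2012, Def 4.9 (vi) p.157] -/
def badOnly (l : ℕ) : PlaceData Unit := ⟨l, fun _ => PlaceKind.bad, (), rfl⟩

/-- The global realified Frobenioid of the witness: objects = real numbers (arithmetic divisors supported at the one
place), isomorphism = equality, degree = the number, one local component. [cite: Mochizuki2012, Def 4.9 (viii) p.158] -/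
abbrev realLine : RealifiedGlobalFrobenioidF.{0, 0} Unit where
  Obj := ℝ
  Iso := Eq
  iso_equivalence := eq_equivalence
  deg := id
  deg_iso := fun _ _ h => h ▸ rfl
  localDeg a _ := a
  localDeg_finite _ := Set.toFinite _
  deg_eq_finsum a := by
    show a = ∑ᶠ _ : Unit, a
    exact (finsum_unique (fun _ : Unit => a)).symm

/-- **IUTchII:Def4.9(viii)** (kurims p.158) STRIP-LEVEL NON-VACUITY: for every prime `p` and every `l` there is a
`×`/`×μ`-group-theoretic-units datum `X` over the trivial group such that the print-level groupoid
`FVdashSplitTriMuPrimeStrip (badOnly l) (fun _ => Unit) X` of `F^{⊩▶×μ}`-prime-strips is INHABITED — by the strip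
with local monoid `ℤ_[p] ∖ {0}` (trivial action, tautological Kummer structures, splitting `p^ℕ`, `O^⊥/μ_{2l} = O^▷/O^×`
by `OPerpPresentsAssociates_nonZeroDivisors_powers`), `ρ = ord_p`, generator `p`, realified Frobenioid `realLine`,
pilot object `−1 = −ρ(p)`. [cite: Mochizuki2012, Def 4.9 (viii) p.158] -/
theorem nonempty (p : ℕ) [Fact p.Prime] (l : ℕ) :
    ∃ X : ∀ _ : Unit, GroupTheoreticUnits.{0, 0} Unit,
      Nonempty (FVdashSplitTriMuPrimeStrip.{0, 0, 0} (badOnly l) (fun _ => Unit) X) := by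
  let M : CoveringMonoid.{0, 0} Unit := ⟨CommMonCat.of (ℤ_[p])⁰, 1⟩
  let X : GroupTheoreticUnits.{0, 0} Unit :=
    { OxG := M.Oˣ, act := M.unitsAct, openSubgroups := Set.univ, zhatUnits := ⊥,
      zhatUnits_comm := fun γ hγ g => by rw [Subgroup.mem_bot.mp hγ, one_mul, mul_one] }
  obtain ⟨κ⟩ := nonempty_kummerTimes_tautological Unit M Set.univ
  obtain ⟨κμ⟩ := nonempty_kummerTimesMu_tautological Unit M Set.univ
  let D : NonarchTriMuDatum.{0, 0, 0} l PlaceKind.bad Unit X :=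
    ⟨CommMonCat.of (ℤ_[p])⁰, 1, Submonoid.powers (varpi p),
      OPerpPresentsAssociates_nonZeroDivisors_powers (PadicInt.irreducible_p (p := p)) (torsionOrder l .bad),
      κ, κμ⟩
  refine ⟨fun _ => X, ⟨⟨{ realifiedF := realLine
                          strip := ⟨fun _ => LocalTriMuDatum.bad D⟩
                          rho := fun _ => rho p
                          triGen := fun _ _ => toOTri _ (varpi p)
                          rho_triGen_pos := fun _ _ => ?_
                          pilot := (-1 : ℝ)
                          pilot_localDeg_bad := fun _ _ => ?_
                          pilot_localDeg_other := fun _ h => (h rfl).elim }⟩⟩⟩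
  · show 0 < Multiplicative.toAdd (rho p (toOTri _ (varpi p)))
    rw [rho_varpi, toAdd_ofAdd]; exact one_pos
  · show (-1 : ℝ) = -((Multiplicative.toAdd (rho p (toOTri _ (varpi p))) : ℝ≥0) : ℝ)
    rw [rho_varpi, toAdd_ofAdd, NNReal.coe_one]

/-- **IUTchIII:Thm2.2(i)** (kurims p.65) «the second arrows in each line are surjections», NON-VACUOUSLY: at the witness
strip, `Aut_{F^{⊩▶×μ}}(S) → Aut_{F^{⊢×μ}}(S)` is surjective (instance of abc-iut-w4-d028's
`mapAut_toTimesMu_surjective`; the point is that the domain type is inhabited). [claim: Mochizuki2012, status: disputed] -/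
theorem mapAut_toTimesMu_surjective_strip (p : ℕ) [Fact p.Prime] (l : ℕ) :
    ∃ (X : ∀ _ : Unit, GroupTheoreticUnits.{0, 0} Unit)
      (S : FVdashSplitTriMuPrimeStrip.{0, 0, 0} (badOnly l) (fun _ => Unit) X),
      Function.Surjective ((toSplitStripFunctor ⋙ FSplitTriMuPrimeStrip.toTimesMuFunctor).mapAut S) := by
  obtain ⟨X, ⟨S⟩⟩ := nonempty p l
  exact ⟨X, S, mapAut_toTimesMu_surjective S⟩

end Witness

end FVdashSplitTriMuPrimeStrip

/-! ### §2 The `O^▷`-level twin of F-d014-RPS-1 (abc-iut-w4-d014, `RealifiedPrimeStripSplitKitRuleWitness`) -/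

namespace FVdashTriMuPrimeStripF

variable {V : Type u} {P : PlaceData V} {G : V → Type u} [∀ v, Group (G v)]
  {X : ∀ v, GroupTheoreticUnits.{u, w} (G v)}

/-- The realified Frobenioid of `M` with every object duplicated `Set (Obj)`-many times (same isomorphism relation on
the first component and equality on the tag, same degrees, same local components). (bookkeeping) [folklore] -/
def dupRealifiedObj (C : RealifiedGlobalFrobenioidF.{u, v} V) : RealifiedGlobalFrobenioidF.{u, v} V where
  Obj := C.Obj × Set C.Obj
  Iso a b := C.Iso a.1 b.1 ∧ a.2 = b.2
  iso_equivalence :=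
    ⟨fun a => ⟨C.iso_equivalence.refl a.1, rfl⟩, fun h => ⟨C.iso_equivalence.symm h.1, h.2.symm⟩,
      fun h h' => ⟨C.iso_equivalence.trans h.1 h'.1, h.2.trans h'.2⟩⟩
  deg a := C.deg a.1
  deg_iso a b h := C.deg_iso a.1 b.1 h.1
  localDeg a := C.localDeg a.1
  localDeg_finite a := C.localDeg_finite a.1
  deg_eq_finsum a := C.deg_eq_finsum a.1

/-- The `O^▷`-level strip `M` with its realified Frobenioid duplicated; pilot `(pilot, ∅)`. (bookkeeping) [folklore] -/
def dup (M : FVdashTriMuPrimeStripF.{u, v, w} P G X) : FVdashTriMuPrimeStripF.{u, v, w} P G X where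
  realifiedF := dupRealifiedObj M.realifiedF
  strip := M.strip
  rho := M.rho
  triGen := M.triGen
  rho_triGen_pos := M.rho_triGen_pos
  pilot := (M.pilot, ∅)
  pilot_localDeg_bad := M.pilot_localDeg_bad
  pilot_localDeg_other := M.pilot_localDeg_other

/-- **IUTchII:Def4.9(viii)** (kurims p.158) The `O^▷`-level twin of abc-iut-w4-d014's F-d014-RPS-1 (`FVdashSplitTriMuPrimeStrip.not_forall_nonempty_iso`, p416106) for abc-iut-L6-t2's `O^▷`-LEVEL groupoid of `F^{⊩▶×μ}`-prime-strips
(`RealifiedPrimeStripCategories`, morphisms carry a bijection `objEquiv` of OBJECTS of `*C^⊩`): no `M` has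
`∀ S, Nonempty (S ≅ M)` — `dup M` would give an injection `Set (Obj M) ↪ Obj M` (Cantor). The hypothesis of
`FVdashTriMuPrimeStripF.iso_nonempty_of_model` is never instantiable. [cite: Mochizuki2012, Def 4.9 (viii) p.158] -/
theorem not_forall_nonempty_iso (M : FVdashTriMuPrimeStripF.{u, v, w} P G X) :
    ¬ ∀ S : FVdashTriMuPrimeStripF.{u, v, w} P G X, Nonempty (S ≅ M) := by
  intro h
  obtain ⟨e⟩ := h (dup M)
  refine Function.cantor_injective (fun s : Set M.realifiedF.Obj => e.hom.objEquiv (M.pilot, s)) ?_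
  intro s t hst
  have := e.hom.objEquiv.injective hst
  exact (Prod.ext_iff.1 this).2

end FVdashTriMuPrimeStripF

/-! ### §3 The connected component of a model: the kit rule holds there and `F^{⊩▶×μ} ↦ F^{⊢×μ}` is full -/

namespace FVdashSplitTriMuPrimeStrip

variable {V : Type u} {P : PlaceData V} {G : V → Type u} [∀ v, Group (G v)]
  {X : ∀ v, GroupTheoreticUnits.{u, w} (G v)}

/-- **IUTchII:Cor4.10(iv)** (kurims p.160) «which coincides with the full poly-isomorphism», REPAIRED CURRENCY: for two
print-level `F^{⊩▶×μ}`-prime-strips that ARE isomorphic (print: both «isomorphic to `‡F`», Def 4.9 (viii)), passing to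
`F^{⊢×μ}` carries the full poly-isomorphism ONTO the full poly-isomorphism (one line from abc-iut-w4-d028's
`mapIso_toTimesMu_surjective_of_iso`; replaces the `_of_model` form, whose hypothesis abc-iut-w4-d014's `not_forall_nonempty_iso` (p416106) shows unsatisfiable).
[claim: Mochizuki2012, status: disputed] -/
theorem map_full_toTimesMu_of_iso {S T : FVdashSplitTriMuPrimeStrip.{u, v, w} P G X} (e : S ≅ T) :
    (PolyIso.full S T).map (toSplitStripFunctor ⋙ FSplitTriMuPrimeStrip.toTimesMuFunctor) = PolyIso.full _ _ := by
  ext φ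
  simp only [PolyIso.mem_map, PolyIso.mem_full, true_and, iff_true]
  exact mapIso_toTimesMu_surjective_of_iso e φ

/-- The object property «isomorphic to the model `M`» on print-level `F^{⊩▶×μ}`-prime-strips — print's «collection
of data … isomorphic to `‡F`» (Def 4.9 (vii)/(viii)). [cite: Mochizuki2012, Def 4.9 (viii) p.158] -/
def kitProperty (M : FVdashSplitTriMuPrimeStrip.{u, v, w} P G X) :
    ObjectProperty (FVdashSplitTriMuPrimeStrip.{u, v, w} P G X) := fun S => Nonempty (S ≅ M)

/-- The connected full subgroupoid of print-level `F^{⊩▶×μ}`-prime-strips through a model `M` (the strips `S` with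
`Nonempty (S ≅ M)`), as a TYPE with the induced (full subcategory) groupoid structure. This — not the whole record
type, cf. abc-iut-w4-d014's `FVdashSplitTriMuPrimeStrip.not_forall_nonempty_iso` (p416106) — is what a strip frame's `Fglxm` with a connectedness field can be.
[cite: Mochizuki2012, Def 4.9 (viii) p.158] -/
abbrev KitComponent (M : FVdashSplitTriMuPrimeStrip.{u, v, w} P G X) : Type (max u (v + 1) w) :=
  (kitProperty M).FullSubcategory

/-- **IUTchII:Def4.9(viii)** (kurims p.158) ON the component the kit rule HOLDS (by definition of the component): any two
objects are isomorphic in the full subcategory. [cite: Mochizuki2012, Def 4.9 (viii) p.158] -/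
theorem KitComponent.iso_nonempty (M : FVdashSplitTriMuPrimeStrip.{u, v, w} P G X) (A B : KitComponent M) :
    Nonempty (A ≅ B) := by
  obtain ⟨eA⟩ := A.property
  obtain ⟨eB⟩ := B.property
  exact ⟨(kitProperty M).isoMk (eA ≪≫ eB.symm)⟩

/-- **IUTchII:Cor4.10(iv)** (kurims p.160) On the component, passing to `F^{⊢×μ}` (restricted along the inclusion
`(kitProperty M).ι`) is surjective on EVERY `Isom(A, B)` — the shape of the frame-level residual `R` of
`UnitMuCoricFrame` for a strip frame whose `Fglxm` is `KitComponent M`. [claim: Mochizuki2012, status: disputed] -/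
theorem KitComponent.mapIso_toTimesMu_surjective (M : FVdashSplitTriMuPrimeStrip.{u, v, w} P G X)
    (A B : KitComponent M) :
    Function.Surjective
      (((kitProperty M).ι ⋙ toSplitStripFunctor ⋙ FSplitTriMuPrimeStrip.toTimesMuFunctor).mapIso :
        (A ≅ B) → _) := by
  intro φ
  obtain ⟨eA⟩ := A.property
  obtain ⟨eB⟩ := B.property
  obtain ⟨f, hf⟩ := mapIso_toTimesMu_surjective_of_iso (S := A.obj) (T := B.obj) (eA ≪≫ eB.symm) φ
  exact ⟨(kitProperty M).isoMk f, Iso.ext (congrArg Iso.hom hf)⟩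

/-- **IUTchII:Cor4.10(iv)** (kurims p.160) … hence, on the component, the image of the full poly-isomorphism is the full
poly-isomorphism, for ALL objects `A`, `B`. [claim: Mochizuki2012, status: disputed] -/
theorem KitComponent.map_full_toTimesMu (M : FVdashSplitTriMuPrimeStrip.{u, v, w} P G X) (A B : KitComponent M) :
    (PolyIso.full A B).map ((kitProperty M).ι ⋙ toSplitStripFunctor ⋙ FSplitTriMuPrimeStrip.toTimesMuFunctor) =
      PolyIso.full _ _ := by
  ext φ
  simp only [PolyIso.mem_map, PolyIso.mem_full, true_and, iff_true]
  exact KitComponent.mapIso_toTimesMu_surjective M A B φ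

end FVdashSplitTriMuPrimeStrip

end Literature.IUT.HodgeArakelov
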